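import Literature.NumberTheory.LFunctions.SymmetricHadamardExpansion
import Literature.Analysis.Complex.TermwiseIteratedDeriv
import HarnessLib

/-!
# Higher derivatives of the Hadamard expansion of `F'/F` for a symmetric entire function

Topic `Literature/NumberTheory/LFunctions`, namespace `Literature.NumberTheory.LFunctions.Stark1974`
(continuation of `SymmetricHadamardExpansion`).  Everything here is PROVED; `SymmHadamardData.term` is a
definition with body (the `n`-th term of the expansion as a function).

For `D : SymmHadamardData F` (so `F(1/2 + z) = z^{2m} A ∏ₙ (1 + cₙ z²)`, `∑ |cₙ| < ∞`) and a point `s`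
with `F(s) ≠ 0` we differentiate the expansion
`F'/F(s) = 2m/(s − 1/2) + ∑ₙ 2cₙ(s − 1/2)/(1 + cₙ(s − 1/2)²)` termwise `k` times:

* `hasSum_iteratedDeriv_term` — `∑ₙ (termₙ)^{(k)}(s) = (F'/F)^{(k)}(s) − (2m/(· − 1/2))^{(k)}(s)`;
* `iteratedDeriv_term_eq` — `(termₙ)^{(k)}(s) = (−1)^k k! [ (s − 1/2 − ζₙ)^{−k−1} + (s − 1/2 + ζₙ)^{−k−1} ]`
  (`ζₙ = D.node n`, `cₙ ≠ 0`), `iteratedDeriv_term_eq_zero` (`cₙ = 0`), `iteratedDeriv_pole_eq`;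
* `iteratedDeriv_logDeriv_eq` — the assembled explicit formula
  `(F'/F)^{(k)}(s) = (−1)^k k! ( 2m (s − 1/2)^{−k−1} + ∑ₙ [ (s − ρₙ)^{−k−1} + (s − ρₙ')^{−k−1} ] )`
  with `ρₙ = 1/2 + ζₙ`, `ρₙ' = 1/2 − ζₙ` the zeros of `F`, and `summable_zeroTerm` — its summability;
* `exists_two_indices_of_deriv_eq_zero` — a multiple zero `ρ ≠ 1/2` of `F` is carried by two distinct
  indices (bookkeeping of multiplicities in the zero sum).

This is the exact "explicit formula for higher derivatives of `−L'/L`" used in the Deuring–Heilbronn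
phenomenon [cite: LagariasMontgomeryOdlyzko1979, §3] [cite: ThornerZaman2017, §7], in the abstract
setting of a symmetric entire function of order `< 2`.  The termwise differentiation is
`Literature.Analysis.Complex.hasSum_iteratedDeriv_of_summable_norm` (Cauchy's formula + dominated
convergence) on a small disc around `s` free of zeros of `F`.

## References

* J. C. Lagarias, H. L. Montgomery, A. M. Odlyzko, *A bound for the least prime ideal in the Chebotarev
  density theorem*, Invent. Math. 54 (1979), §3. [LagariasMontgomeryOdlyzko1979]
* J. Thorner, A. Zaman, *An explicit bound for the least prime ideal in the Chebotarev density theorem*,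
  Algebra Number Theory 11 (2017), arXiv:1604.01750, §7. [ThornerZaman2017]
* H. M. Stark, *Some effective cases of the Brauer–Siegel theorem*, Invent. Math. 23 (1974), Lemma 3. [Stark1974]
-/

noncomputable section

open Complex Metric Set Filter Topology

namespace Literature.NumberTheory.LFunctions.Stark1974

namespace SymmHadamardData

open Literature.Analysis.Complex (iteratedDeriv_inv_sub_const hasSum_iteratedDeriv_of_summable_norm)

variable {F : ℂ → ℂ} (D : SymmHadamardData F)

/-- The `n`-th term of the Hadamard expansion of `F'/F`, as a function of `s`:
`termₙ(s) = 2cₙ(s − 1/2)/(1 + cₙ(s − 1/2)²)`. [cite: Stark1974, Lemma 3 (proof)] -/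
def term (n : ℕ) (z : ℂ) : ℂ := 2 * D.c n * (z - 1 / 2) / (1 + D.c n * (z - 1 / 2) ^ 2)

/-- Unfolding `term`. [folklore] -/
theorem term_apply (n : ℕ) (z : ℂ) : D.term n z = 2 * D.c n * (z - 1 / 2) / (1 + D.c n * (z - 1 / 2) ^ 2) :=
  rfl

/-- Each term is differentiable at every point where `F ≠ 0`. [folklore] -/
theorem differentiableAt_term {z : ℂ} (hz : F z ≠ 0) (n : ℕ) : DifferentiableAt ℂ (D.term n) z := by
  have h := D.factor_ne_zero hz n
  show DifferentiableAt ℂ (fun z ↦ 2 * D.c n * (z - 1 / 2) / (1 + D.c n * (z - 1 / 2) ^ 2)) z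
  exact ((differentiableAt_const _).mul (differentiableAt_id.sub_const _)).div
    ((differentiableAt_const _).add ((differentiableAt_const _).mul ((differentiableAt_id.sub_const _).pow 2))) h

/-- The pole part `2m/(z − 1/2)` is differentiable at every point where `F ≠ 0`. [folklore] -/
theorem differentiableAt_pole {z : ℂ} (hz : F z ≠ 0) :
    DifferentiableAt ℂ (fun z : ℂ ↦ 2 * (D.m : ℂ) / (z - 1 / 2)) z := by
  rcases D.m_eq_zero_or_ne_half hz with hm | hne
  · have : (fun z : ℂ ↦ 2 * (D.m : ℂ) / (z - 1 / 2)) = fun _ ↦ 0 := by funext w; simp [hm]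
    rw [this]; exact differentiableAt_const _
  · exact (differentiableAt_const _).div (differentiableAt_id.sub_const _) (sub_ne_zero.mpr hne)

/-- `F'/F` is differentiable at every point where `F ≠ 0` (for `F` entire). [folklore] -/
theorem differentiableAt_logDeriv (hF : Differentiable ℂ F) {z : ℂ} (hz : F z ≠ 0) :
    DifferentiableAt ℂ (logDeriv F) z := by
  have hF' : DifferentiableAt ℂ (deriv F) z := ((hF.analyticAt z).deriv).differentiableAt
  have : logDeriv F = fun w ↦ deriv F w / F w := by funext w; rw [logDeriv_apply]
  rw [this]
  exact hF'.div (hF z) hz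

/-- A closed disc around a non-zero of `F` free of zeros. [folklore] -/
theorem exists_closedBall_ne_zero (hF : Differentiable ℂ F) {s : ℂ} (hs : F s ≠ 0) :
    ∃ R > 0, ∀ z ∈ closedBall s R, F z ≠ 0 := by
  have hev : ∀ᶠ z in 𝓝 s, F z ≠ 0 := (hF s).continuousAt.eventually_ne hs
  rcases Metric.nhds_basis_closedBall.eventually_iff.mp hev with ⟨R, hR, h⟩
  exact ⟨R, hR, fun z hz ↦ h hz⟩

/-- **Termwise `k`-th derivatives of the Hadamard expansion.**  At a point with `F(s) ≠ 0`,
`∑ₙ (termₙ)^{(k)}(s) = (F'/F)^{(k)}(s) − (2m/(· − 1/2))^{(k)}(s)`.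
[cite: LagariasMontgomeryOdlyzko1979, §3] [cite: ThornerZaman2017, §7] -/
theorem hasSum_iteratedDeriv_term (hF : Differentiable ℂ F) {s : ℂ} (hs : F s ≠ 0) (k : ℕ) :
    HasSum (fun n ↦ iteratedDeriv k (D.term n) s)
      (iteratedDeriv k (logDeriv F) s - iteratedDeriv k (fun z : ℂ ↦ 2 * (D.m : ℂ) / (z - 1 / 2)) s) := by
  obtain ⟨R, hR, hne⟩ := exists_closedBall_ne_zero hF hs
  set P : ℂ → ℂ := fun z ↦ 2 * (D.m : ℂ) / (z - 1 / 2) with hP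
  set g : ℂ → ℂ := fun z ↦ logDeriv F z - P z with hg
  -- the radius bound `‖z − 1/2‖ ≤ ρ` on the circle
  set ρ : ℝ := ‖s - 1 / 2‖ + R with hρ
  have hρpos : 0 < ρ := by positivity
  have hzρ : ∀ z ∈ sphere s R, ‖z - 1 / 2‖ ≤ ρ := by
    intro z hz
    rw [mem_sphere, dist_eq_norm] at hz
    calc ‖z - 1 / 2‖ = ‖(z - s) + (s - 1 / 2)‖ := by ring_nf
      _ ≤ ‖z - s‖ + ‖s - 1 / 2‖ := norm_add_le _ _
      _ = ρ := by rw [hz, hρ, add_comm]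
  -- per-term bounds on the (compact) circle
  have hcont : ∀ n, ContinuousOn (D.term n) (sphere s R) := fun n z hz ↦
    (D.differentiableAt_term (hne z (sphere_subset_closedBall hz)) n).continuousAt.continuousWithinAt
  choose B hB using fun n ↦ (isCompact_sphere s R).exists_bound_of_continuousOn (hcont n)
  -- the dominating sequence
  set u : ℕ → ℝ := fun n ↦ if ‖D.c n‖ < 1 / (2 * ρ ^ 2) then 4 * ρ * ‖D.c n‖ else B n with hu_def
  have hsmall : ∀ᶠ n in cofinite, ‖D.c n‖ < 1 / (2 * ρ ^ 2) := by
    have ht : Tendsto (fun n ↦ ‖D.c n‖) cofinite (𝓝 0) := by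
      have := D.summable.tendsto_cofinite_zero
      simpa using this
    exact ht.eventually (gt_mem_nhds (by positivity))
  have hu : Summable u := by
    refine (D.summable.mul_left (4 * ρ)).congr_cofinite ?_
    filter_upwards [hsmall] with n hn
    rw [hu_def]; dsimp only; rw [if_pos hn]
  have hle : ∀ n, ∀ z ∈ sphere s R, ‖D.term n z‖ ≤ u n := by
    intro n z hz
    rw [hu_def]; dsimp only
    split_ifs with h
    · -- small `cₙ`: `|1 + cₙ w²| ≥ 1/2`
      have hw := hzρ z hz
      have hcw : ‖D.c n * (z - 1 / 2) ^ 2‖ ≤ 1 / 2 := by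
        rw [norm_mul, norm_pow]
        calc ‖D.c n‖ * ‖z - 1 / 2‖ ^ 2 ≤ 1 / (2 * ρ ^ 2) * ρ ^ 2 := by
              apply mul_le_mul h.le (pow_le_pow_left₀ (norm_nonneg _) hw 2) (by positivity) (by positivity)
          _ = 1 / 2 := by field_simp
      have hden : 1 / 2 ≤ ‖1 + D.c n * (z - 1 / 2) ^ 2‖ := by
        have := norm_sub_norm_le (1 : ℂ) (-(D.c n * (z - 1 / 2) ^ 2))
        rw [sub_neg_eq_add, norm_neg, norm_one] at this
        linarith
      rw [term_apply, norm_div, norm_mul, norm_mul, Complex.norm_two, div_le_iff₀ (by linarith)]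
      nlinarith [mul_nonneg (sub_nonneg.mpr hden) (mul_nonneg hρpos.le (norm_nonneg (D.c n))),
        mul_nonneg (sub_nonneg.mpr hw) (norm_nonneg (D.c n))]
    · exact hB n z hz
  -- summation on the circle, from `logDeriv_eq`
  have hsum : ∀ z ∈ sphere s R, HasSum (fun n ↦ D.term n z) (g z) := by
    intro z hz
    have hFz := hne z (sphere_subset_closedBall hz)
    have h1 := D.logDeriv_eq hF hFz
    have h2 := (D.summable_terms (z - 1 / 2)).hasSum
    have hgz : g z = ∑' n, 2 * D.c n * (z - 1 / 2) / (1 + D.c n * (z - 1 / 2) ^ 2) := by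
      rw [hg]; dsimp only; rw [h1, hP]; ring
    rw [hgz]
    exact h2
  -- differentiability on the closed disc
  have hf : ∀ n, DifferentiableOn ℂ (D.term n) (closedBall s R) := fun n z hz ↦
    (D.differentiableAt_term (hne z hz) n).differentiableWithinAt
  have hgd : DifferentiableOn ℂ g (closedBall s R) := fun z hz ↦
    ((differentiableAt_logDeriv hF (hne z hz)).sub (D.differentiableAt_pole (hne z hz))).differentiableWithinAt
  have key := hasSum_iteratedDeriv_of_summable_norm hR hu hf hle hgd hsum k
  -- split `g^{(k)} = (F'/F)^{(k)} − P^{(k)}` (both analytic near `s`)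
  set U : Set ℂ := {z | F z ≠ 0} with hU
  have hUo : IsOpen U := isOpen_ne_fun hF.continuous continuous_const
  have hsU : U ∈ 𝓝 s := hUo.mem_nhds hs
  have hL : ContDiffAt ℂ k (logDeriv F) s :=
    ((DifferentiableOn.analyticAt (fun z hz ↦ (differentiableAt_logDeriv hF hz).differentiableWithinAt) hsU)).contDiffAt
  have hPc : ContDiffAt ℂ k P s :=
    ((DifferentiableOn.analyticAt (fun z hz ↦ (D.differentiableAt_pole hz).differentiableWithinAt) hsU)).contDiffAt
  have hsplit : iteratedDeriv k g s = iteratedDeriv k (logDeriv F) s - iteratedDeriv k P s := by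
    rw [hg]
    exact iteratedDeriv_fun_sub hL hPc
  rwa [hsplit] at key

/-- `k`-th derivative of the pole part: `(2m/(· − 1/2))^{(k)}(s) = (−1)^k k! · 2m (s − 1/2)^{−(k+1)}`.
[folklore] -/
theorem iteratedDeriv_pole_eq (k : ℕ) (s : ℂ) :
    iteratedDeriv k (fun z : ℂ ↦ 2 * (D.m : ℂ) / (z - 1 / 2)) s =
      (-1) ^ k * k.factorial * (2 * D.m * ((s - 1 / 2) ^ (k + 1))⁻¹) := by
  have : (fun z : ℂ ↦ 2 * (D.m : ℂ) / (z - 1 / 2)) = fun z ↦ 2 * (D.m : ℂ) * (fun w : ℂ ↦ (w - 1 / 2)⁻¹) z := by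
    funext z; rw [div_eq_mul_inv]
  rw [this, iteratedDeriv_const_mul_field, iteratedDeriv_inv_sub_const]
  ring

/-- `k`-th derivative of a term with `cₙ ≠ 0`:
`(termₙ)^{(k)}(s) = (−1)^k k! [ (s − 1/2 − ζₙ)^{−(k+1)} + (s − 1/2 + ζₙ)^{−(k+1)} ]`.
[cite: LagariasMontgomeryOdlyzko1979, §3] -/
theorem iteratedDeriv_term_eq {s : ℂ} (hs : F s ≠ 0) {n : ℕ} (hn : D.c n ≠ 0) (k : ℕ) :
    iteratedDeriv k (D.term n) s = (-1) ^ k * k.factorial *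
      (((s - 1 / 2 - D.node n) ^ (k + 1))⁻¹ + ((s - 1 / 2 + D.node n) ^ (k + 1))⁻¹) := by
  -- near `s` the factor does not vanish, so the term is `(z − 1/2 − ζ)⁻¹ + (z − 1/2 + ζ)⁻¹`
  have hcont : ContinuousAt (fun z : ℂ ↦ 1 + D.c n * (z - 1 / 2) ^ 2) s := by fun_prop
  have hev : D.term n =ᶠ[𝓝 s]
      fun z ↦ (fun w : ℂ ↦ (w - (1 / 2 + D.node n))⁻¹) z + (fun w : ℂ ↦ (w - (1 / 2 - D.node n))⁻¹) z := by
    filter_upwards [hcont.eventually_ne (D.factor_ne_zero hs n)] with z hz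
    rw [term_apply, D.term_eq_of_ne hn hz]
    ring_nf
  have hnz := D.sub_node_ne_zero hn (D.factor_ne_zero hs n)
  have h1 : ContDiffAt ℂ k (fun w : ℂ ↦ (w - (1 / 2 + D.node n))⁻¹) s :=
    (contDiffAt_id.sub contDiffAt_const).inv (by
      have := hnz.1; intro h; apply this; simp only [id] at h; linear_combination h)
  have h2 : ContDiffAt ℂ k (fun w : ℂ ↦ (w - (1 / 2 - D.node n))⁻¹) s :=
    (contDiffAt_id.sub contDiffAt_const).inv (by
      have := hnz.2; intro h; apply this; simp only [id] at h; linear_combination h)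
  rw [hev.iteratedDeriv_eq, iteratedDeriv_fun_add h1 h2, iteratedDeriv_inv_sub_const,
    iteratedDeriv_inv_sub_const]
  ring_nf

/-- `k`-th derivative of a term with `cₙ = 0` vanishes. [folklore] -/
theorem iteratedDeriv_term_eq_zero {n : ℕ} (hn : D.c n = 0) (k : ℕ) (s : ℂ) :
    iteratedDeriv k (D.term n) s = 0 := by
  have : D.term n = fun _ ↦ 0 := funext fun z ↦ D.term_eq_zero_of_eq hn (z - 1 / 2)
  rw [this, iteratedDeriv_const]
  simp

/-- The zero-sum summand attached to the index `n`:
`Zₙ(k,s) = (s − 1/2 − ζₙ)^{−(k+1)} + (s − 1/2 + ζₙ)^{−(k+1)}` if `cₙ ≠ 0`, else `0`; here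
`1/2 ± ζₙ` are the two zeros of `F` carried by the `n`-th factor. [cite: LagariasMontgomeryOdlyzko1979, §3] -/
def zeroTerm (k : ℕ) (s : ℂ) (n : ℕ) : ℂ :=
  if D.c n = 0 then 0 else ((s - 1 / 2 - D.node n) ^ (k + 1))⁻¹ + ((s - 1 / 2 + D.node n) ^ (k + 1))⁻¹

/-- `(termₙ)^{(k)}(s) = (−1)^k k! Zₙ(k,s)`. [folklore] -/
theorem iteratedDeriv_term_eq_zeroTerm {s : ℂ} (hs : F s ≠ 0) (k n : ℕ) :
    iteratedDeriv k (D.term n) s = (-1) ^ k * k.factorial * D.zeroTerm k s n := by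
  unfold zeroTerm
  split_ifs with hn
  · rw [D.iteratedDeriv_term_eq_zero hn, mul_zero]
  · exact D.iteratedDeriv_term_eq hs hn k

/-- The zero sum `∑ₙ Zₙ(k,s)` converges (to `((−1)^k k!)⁻¹ [ (F'/F)^{(k)}(s) − pole part ]`).
[cite: LagariasMontgomeryOdlyzko1979, §3] -/
theorem hasSum_zeroTerm (hF : Differentiable ℂ F) {s : ℂ} (hs : F s ≠ 0) (k : ℕ) :
    HasSum (D.zeroTerm k s) (((-1) ^ k * k.factorial : ℂ)⁻¹ *
      (iteratedDeriv k (logDeriv F) s - (-1) ^ k * k.factorial * (2 * D.m * ((s - 1 / 2) ^ (k + 1))⁻¹))) := by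
  have h := D.hasSum_iteratedDeriv_term hF hs k
  rw [D.iteratedDeriv_pole_eq] at h
  have hne : ((-1) ^ k * k.factorial : ℂ) ≠ 0 :=
    mul_ne_zero (pow_ne_zero _ (by norm_num)) (by exact_mod_cast k.factorial_ne_zero)
  have h' := h.mul_left (((-1) ^ k * k.factorial : ℂ)⁻¹)
  refine h'.congr_fun fun n ↦ ?_
  rw [D.iteratedDeriv_term_eq_zeroTerm hs, ← mul_assoc, inv_mul_cancel₀ hne, one_mul]

/-- Summability of the zero sum. [cite: LagariasMontgomeryOdlyzko1979, §3] -/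
theorem summable_zeroTerm (hF : Differentiable ℂ F) {s : ℂ} (hs : F s ≠ 0) (k : ℕ) :
    Summable (D.zeroTerm k s) :=
  (D.hasSum_zeroTerm hF hs k).summable

/-- **Explicit formula for the higher derivatives of `F'/F`.**  At a point with `F(s) ≠ 0`,
`(F'/F)^{(k)}(s) = (−1)^k k! ( 2m (s − 1/2)^{−(k+1)} + ∑ₙ Zₙ(k,s) )`, the sum running over the
zeros `1/2 ± ζₙ ≠ 1/2` of `F` (grouped in symmetric pairs) and `2m` = the order of vanishing at `1/2`.
[cite: LagariasMontgomeryOdlyzko1979, §3] [cite: ThornerZaman2017, §7] -/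
theorem iteratedDeriv_logDeriv_eq (hF : Differentiable ℂ F) {s : ℂ} (hs : F s ≠ 0) (k : ℕ) :
    iteratedDeriv k (logDeriv F) s =
      (-1) ^ k * k.factorial * (2 * D.m * ((s - 1 / 2) ^ (k + 1))⁻¹ + ∑' n, D.zeroTerm k s n) := by
  have h := (D.hasSum_zeroTerm hF hs k).tsum_eq
  have hne : ((-1) ^ k * k.factorial : ℂ) ≠ 0 :=
    mul_ne_zero (pow_ne_zero _ (by norm_num)) (by exact_mod_cast k.factorial_ne_zero)
  rw [h, mul_add, mul_inv_cancel_left₀ hne]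
  ring

/-- In root form: if `cₙ(ρ − 1/2)² = −1` then `Zₙ(k,s) = (s − ρ)^{−(k+1)} + (s − (1 − ρ))^{−(k+1)}` — the
`n`-th factor carries the symmetric pair of zeros `{ρ, 1 − ρ}`. [folklore] -/
theorem zeroTerm_eq_of_root {ρ : ℂ} {n : ℕ} (h : D.c n * (ρ - 1 / 2) ^ 2 = -1) (k : ℕ) (s : ℂ) :
    D.zeroTerm k s n = ((s - ρ) ^ (k + 1))⁻¹ + ((s - (1 - ρ)) ^ (k + 1))⁻¹ := by
  have hn : D.c n ≠ 0 := by rintro h0; rw [h0, zero_mul] at h; norm_num at h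
  rw [zeroTerm, if_neg hn]
  rcases D.eq_half_add_or_sub_node hn h with h1 | h1
  · have e1 : s - 1 / 2 - D.node n = s - ρ := by rw [h1]; ring
    have e2 : s - 1 / 2 + D.node n = s - (1 - ρ) := by rw [h1]; ring
    rw [e1, e2]
  · have e1 : s - 1 / 2 - D.node n = s - (1 - ρ) := by rw [h1]; ring
    have e2 : s - 1 / 2 + D.node n = s - ρ := by rw [h1]; ring
    rw [e1, e2, add_comm]

/-! ### Double zeros are carried by two distinct indices -/

/-- Removing one coefficient keeps `∑ |cₙ| < ∞`. [folklore] -/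
theorem summable_norm_update_zero (n₀ : ℕ) : Summable fun n ↦ ‖Function.update D.c n₀ 0 n‖ := by
  refine Summable.of_nonneg_of_le (fun n ↦ norm_nonneg _) (fun n ↦ ?_) D.summable
  by_cases h : n = n₀
  · subst h; simp
  · rw [Function.update_of_ne h]

/-- Splitting off one factor of the canonical product:
`∏ₙ (1 + cₙ z²) = (1 + c_{n₀} z²) · ∏ₙ (1 + c'ₙ z²)`, `c' = c` with `c'_{n₀} = 0`. [folklore] -/
theorem tprod_eq_mul_tprod_update (n₀ : ℕ) (z : ℂ) :
    ∏' n, (1 + D.c n * z ^ 2) =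
      (1 + D.c n₀ * z ^ 2) * ∏' n, (1 + Function.update D.c n₀ 0 n * z ^ 2) := by
  have hupd : Function.update (fun n ↦ 1 + D.c n * z ^ 2) n₀ 1 =
      fun n ↦ 1 + Function.update D.c n₀ 0 n * z ^ 2 := by
    funext n
    by_cases h : n = n₀
    · subst h; simp
    · rw [Function.update_of_ne h, Function.update_of_ne h]
  have hmult : Multipliable (Function.update (fun n ↦ 1 + D.c n * z ^ 2) n₀ 1) := by
    rw [hupd]
    exact (multipliableLocallyUniformlyOn_one_add_mul_sq (D.summable_norm_update_zero n₀)
      (‖z‖ + 1)).multipliable (by simp)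
  rw [Multipliable.tprod_eq_mul_tprod_ite' n₀ hmult]
  congr 1
  refine tprod_congr fun n ↦ ?_
  by_cases h : n = n₀
  · subst h; simp
  · rw [if_neg h, Function.update_of_ne h]

/-- **A multiple zero is carried by two distinct indices.**  If `F(ρ) = F'(ρ) = 0` and `ρ ≠ 1/2`
then there are `n₁ ≠ n₂` with `c_{n₁}(ρ − 1/2)² = c_{n₂}(ρ − 1/2)² = −1` (each quadratic factor has
only simple zeros, so a double zero needs two factors).  Used to net the double pole-type terms of
`Λ(s,χ)Λ(s,χ̄)` against zeros in the Deuring–Heilbronn inequality. [folklore] -/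
theorem exists_two_indices_of_deriv_eq_zero {ρ : ℂ} (hρ : F ρ = 0) (hρ' : deriv F ρ = 0)
    (hhalf : ρ ≠ 1 / 2) :
    ∃ n₁ n₂, n₁ ≠ n₂ ∧ D.c n₁ * (ρ - 1 / 2) ^ 2 = -1 ∧ D.c n₂ * (ρ - 1 / 2) ^ 2 = -1 := by
  obtain ⟨n₀, hn₀, h₀⟩ := D.exists_index_of_zero hρ hhalf
  by_contra hcon
  push Not at hcon
  have hothers : ∀ n, n ≠ n₀ → 1 + D.c n * (ρ - 1 / 2) ^ 2 ≠ 0 := by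
    intro n hn h
    exact hcon n₀ n (Ne.symm hn) h₀ (by linear_combination h)
  have hz₀ne : ρ - 1 / 2 ≠ 0 := sub_ne_zero.mpr hhalf
  set c' : ℕ → ℂ := Function.update D.c n₀ 0 with hc'
  have hc'ne : ∀ n, 1 + c' n * (ρ - 1 / 2) ^ 2 ≠ 0 := by
    intro n
    by_cases h : n = n₀
    · subst h; simp [hc']
    · rw [hc', Function.update_of_ne h]; exact hothers n h
  have hT' : ∏' n, (1 + c' n * (ρ - 1 / 2) ^ 2) ≠ 0 :=
    tprod_one_add_mul_sq_ne_zero (D.summable_norm_update_zero n₀) hc'ne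
  -- `F = (1 + c_{n₀}(· − 1/2)²) · H`
  set H : ℂ → ℂ := fun s ↦ (s - 1 / 2) ^ (2 * D.m) * (D.A * ∏' n, (1 + c' n * (s - 1 / 2) ^ 2))
    with hH
  have hFH : F = fun s ↦ (1 + D.c n₀ * (s - 1 / 2) ^ 2) * H s := by
    funext s
    rw [D.apply_eq s, D.tprod_eq_mul_tprod_update n₀ (s - 1 / 2), hH]
    ring
  have hHρ : H ρ ≠ 0 :=
    mul_ne_zero (pow_ne_zero _ hz₀ne) (mul_ne_zero D.A_ne hT')
  have hHdiff : DifferentiableAt ℂ H ρ := by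
    have h1 : Differentiable ℂ (fun z ↦ ∏' n, (1 + c' n * z ^ 2)) :=
      differentiable_tprod_one_add_mul_sq (D.summable_norm_update_zero n₀)
    have h2 : DifferentiableAt ℂ (fun s : ℂ ↦ ∏' n, (1 + c' n * (s - 1 / 2) ^ 2)) ρ :=
      (h1 (ρ - 1 / 2)).comp ρ (differentiableAt_id.sub_const _)
    exact ((differentiableAt_id.sub_const _).pow _).mul ((differentiableAt_const _).mul h2)
  have hq : HasDerivAt (fun s : ℂ ↦ 1 + D.c n₀ * (s - 1 / 2) ^ 2) (D.c n₀ * (2 * (ρ - 1 / 2))) ρ := by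
    have h := ((((hasDerivAt_id ρ).sub_const (1 / 2 : ℂ)).pow 2).const_mul (D.c n₀)).const_add 1
    simpa using h
  have hderiv : deriv F ρ =
      D.c n₀ * (2 * (ρ - 1 / 2)) * H ρ + (1 + D.c n₀ * (ρ - 1 / 2) ^ 2) * deriv H ρ := by
    have e : deriv F ρ = deriv (fun s ↦ (1 + D.c n₀ * (s - 1 / 2) ^ 2) * H s) ρ :=
      congrArg (fun f : ℂ → ℂ ↦ deriv f ρ) hFH
    rw [e]
    exact (hq.mul hHdiff.hasDerivAt).deriv
  have h1 : 1 + D.c n₀ * (ρ - 1 / 2) ^ 2 = 0 := by linear_combination h₀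
  rw [hρ', h1, zero_mul, add_zero] at hderiv
  exact (mul_ne_zero (mul_ne_zero hn₀ (mul_ne_zero two_ne_zero hz₀ne)) hHρ) hderiv.symm

end SymmHadamardData

end Literature.NumberTheory.LFunctions.Stark1974

end
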